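/-
Copyright (c) 2026. All rights reserved.
Released under Apache 2.0 license as described in the file LICENSE.
Authors: abc-iut cell — seat abc-iut-L4-t7 (gen 5; L4-lead m118 «AUT0-DISC-HOL», residual R3 of the Cor 2.4
author map HOME/staging/L4/abc-iut-L4-t8/g9/census/COR24-CLAUSE-DECL-MAP.md).
-/
import Literature.AnabelianGeometry.AbsoluteAnabelian.HolomorphicCoresIdComponentProofs
import Literature.AnabelianGeometry.AbsoluteAnabelian.AutHolomorphicSpacesRCGroupLemmas
import Literature.AnabelianGeometry.AbsoluteAnabelian.AutHolomorphicSpacesDiscProofs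
import HarnessLib

/-!
# The identity component of the automorphism group of an Aut-holomorphic disc is holomorphic

S. Mochizuki, *Topics in absolute anabelian geometry III*, Cor 2.4 (b)(c) (kurims pp.54–55) writes
`Aut⁰(𝕌) ⊆ Aut(𝕌)` for «the connected component of the identity of `Aut(𝕌)`», `Aut(𝕌)` being the
automorphism group of the Aut-holomorphic disc `𝕌` with the compact-open topology, and recalls
[Prop 2.2 (ii)] that `Aut(𝕌) ≅ GL₂(ℝ)/ℝ^×` — so that `Aut⁰(𝕌) ≅ PSL₂(ℝ)` is the group of HOLOMORPHIC
automorphisms, the other component being the anti-holomorphic ones.  The tree types `Aut(𝕌) = autSet`,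
`Aut⁰(𝕌) = autIdComponent` (`HolomorphicCores.lean`) and proves «biholomorphic ⇒ in `Aut⁰(𝕌)`»
(`mem_autIdComponent_of_mdifferentiable`, abc-iut-L4-t8).  This file proves the CONVERSE:

* `autIdComponent_subset_setOf_mdifferentiable` — every element of `Aut⁰(𝕌)` is biholomorphic;
* `autIdComponent_eq_setOf_mdifferentiable` — hence `Aut⁰(𝕌)` IS the set of biholomorphic
  self-homeomorphisms of `U` (set equality);
* `mdifferentiable_of_mem_autIdComponent` — membership form.

Consequence for Cor 2.4 (c): the commensurator `Π ≤ G = Aut⁰(𝕌)` of `HyperbolicCoreOrbispace` acts on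
`U` by HOLOMORPHIC automorphisms, as an Aut-holomorphic orbispace presentation (Rmk 2.1.1) requires.

Route (Prop 2.2 (i)/(ii) of the tree, Conway VI.2.5): an element `ψ` of `Aut(𝕌)` is RC-holomorphic
(`discAutHolIsoIsRCHolomorphic_holds`), so its disc picture `g` preserves `cosh ρ` and is either a
Möbius map — then `ψ` is biholomorphic — or an anti-Möbius map `z ↦ c φ_a(z̄)`
(`mdifferentiable_or_conj_of_discCosh_pic`).  The ORIENTATION TEST
`V(ψ) := φ_{g(0)}(g(i/2))` versus `U(ψ) := φ_{g(0)}(g(1/2))` separates the two types: `φ_{g(0)} ∘ g`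
(resp. `φ_{g(0)} ∘ g ∘ conj`) fixes `0`, hence is a rotation `z ↦ ζz` (Schwarz), so `V = i·U` in the
Möbius case and `V = −i·U` in the anti-Möbius case, with `|U| = 1/2 ≠ 0`.  Evaluation of pictures is
continuous for the compact-open topology (`continuous_pic_apply`) and `(a, z) ↦ φ_a(z)` is jointly
continuous (`continuousOn_discRot_uncurry`), so `{V = i·U}` is CLOPEN in `Aut(𝕌)`; it contains the
identity, hence the identity component.

PROOF-ONLY: no definitions, no named facts.  Refereed pre-IUT material / classical complex analysis;
nothing here bears on the disputed [IUTchIII] Cor. 3.12; no side is taken.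
-/

noncomputable section

namespace Literature.AnabelianGeometry.AbsoluteAnabelian

open _root_.TopologicalSpace _root_.Topology _root_.Set _root_.Metric _root_.Function _root_.Filter
open scoped _root_.Manifold _root_.ContDiff ComplexConjugate
open Literature.Analysis.Complex

/-! ### The planar orientation test -/

section Planar

/-- `1/2` lies in the open unit disc. [folklore] -/
private theorem half_mem_ball : ((1 : ℂ) / 2) ∈ ball (0 : ℂ) 1 := by
  rw [mem_ball_zero_iff]; norm_num

/-- `i/2` lies in the open unit disc. [folklore] -/
private theorem I_half_mem_ball : (Complex.I / 2) ∈ ball (0 : ℂ) 1 := by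
  rw [mem_ball_zero_iff, norm_div, Complex.norm_I]; norm_num

/-- `-i/2` lies in the open unit disc. [folklore] -/
private theorem neg_I_half_mem_ball : (-(Complex.I / 2)) ∈ ball (0 : ℂ) 1 := by
  rw [mem_ball_zero_iff, norm_neg, norm_div, Complex.norm_I]; norm_num

/-- **Orientation test, Möbius case** (Conway VI.2.5: an automorphism of the disc fixing `0` is a
rotation): for an automorphism `g` of the disc, `φ_{g 0}(g(i/2)) = i · φ_{g 0}(g(1/2))` and
`φ_{g 0}(g(1/2)) ≠ 0`. [cite: Conway1978, Ch. VI Thm. 2.5] -/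
theorem discMobius_apply_eq_I_mul_of_isDiscAut {g : ℂ → ℂ} (hg : IsDiscAut g) :
    _root_.Complex.discMobius (g 0) (g (Complex.I / 2)) =
        Complex.I * _root_.Complex.discMobius (g 0) (g (1 / 2)) ∧
      _root_.Complex.discMobius (g 0) (g (1 / 2)) ≠ 0 := by
  have hb : ‖g 0‖ < 1 := mem_ball_zero_iff.1 (hg.mapsTo (mem_ball_self one_pos))
  -- `h := φ_{g 0} ∘ g` is an automorphism fixing `0`, hence a rotation
  have hh : IsDiscAut (_root_.Complex.discMobius (g 0) ∘ g) := (isDiscAut_discMobius hb).comp hg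
  have hh0 : (_root_.Complex.discMobius (g 0) ∘ g) 0 = 0 := by simp
  obtain ⟨ζ, hζ, hrot⟩ := hh.exists_eq_mul_of_map_zero hh0
  have h1 : _root_.Complex.discMobius (g 0) (g (1 / 2)) = ζ * (1 / 2) := hrot half_mem_ball
  have h2 : _root_.Complex.discMobius (g 0) (g (Complex.I / 2)) = ζ * (Complex.I / 2) :=
    hrot I_half_mem_ball
  have hζ0 : ζ ≠ 0 := by
    intro h; rw [h, norm_zero] at hζ; exact zero_ne_one hζ
  refine ⟨?_, ?_⟩
  · rw [h1, h2]; ring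
  · rw [h1]; exact mul_ne_zero hζ0 (by norm_num)

/-- **Orientation test, anti-Möbius case**: if `g = k ∘ conj` on the disc for an automorphism `k` of
the disc, then `φ_{g 0}(g(i/2)) = −i · φ_{g 0}(g(1/2))` and `φ_{g 0}(g(1/2)) ≠ 0`.
[cite: Conway1978, Ch. VI Thm. 2.5] -/
theorem discMobius_apply_eq_neg_I_mul_of_eqOn_conj {g k : ℂ → ℂ} (hk : IsDiscAut k)
    (hgk : EqOn g (fun z => k (conj z)) (ball 0 1)) :
    _root_.Complex.discMobius (g 0) (g (Complex.I / 2)) =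
        -Complex.I * _root_.Complex.discMobius (g 0) (g (1 / 2)) ∧
      _root_.Complex.discMobius (g 0) (g (1 / 2)) ≠ 0 := by
  have hg0 : g 0 = k 0 := by
    have := hgk (mem_ball_self one_pos); simpa using this
  have hg1 : g (1 / 2) = k (1 / 2) := by
    have := hgk half_mem_ball
    simp only at this
    rw [this, map_div₀, map_one, map_ofNat]
  have hg2 : g (Complex.I / 2) = k (-(Complex.I / 2)) := by
    have := hgk I_half_mem_ball
    simp only at this
    rw [this, map_div₀, Complex.conj_I, map_ofNat, neg_div]
  have hb : ‖k 0‖ < 1 := mem_ball_zero_iff.1 (hk.mapsTo (mem_ball_self one_pos))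
  have hh : IsDiscAut (_root_.Complex.discMobius (k 0) ∘ k) := (isDiscAut_discMobius hb).comp hk
  have hh0 : (_root_.Complex.discMobius (k 0) ∘ k) 0 = 0 := by simp
  obtain ⟨ζ, hζ, hrot⟩ := hh.exists_eq_mul_of_map_zero hh0
  have h1 : _root_.Complex.discMobius (k 0) (k (1 / 2)) = ζ * (1 / 2) := hrot half_mem_ball
  have h2 : _root_.Complex.discMobius (k 0) (k (-(Complex.I / 2))) = ζ * (-(Complex.I / 2)) :=
    hrot neg_I_half_mem_ball
  have hζ0 : ζ ≠ 0 := by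
    intro h; rw [h, norm_zero] at hζ; exact zero_ne_one hζ
  rw [hg0, hg1, hg2]
  refine ⟨?_, ?_⟩
  · rw [h1, h2]; ring
  · rw [h1]; exact mul_ne_zero hζ0 (by norm_num)

end Planar

/-! ### The identity component of `Aut(𝕌)` consists of biholomorphic maps -/

section IdComponent

variable {Y : Type} [TopologicalSpace Y] [T2Space Y] [ChartedSpace ℂ Y] [IsManifold 𝓘(ℂ, ℂ) ω Y]

/-- **`Aut⁰(𝕌)` is holomorphic.**  For an Aut-holomorphic disc `U` (`IsAutHolDisc U`), every element
of the identity component `autIdComponent (AutHolStructure.ofCharted U)` of `Aut(𝕌)` (compact-open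
topology) is a biholomorphic self-homeomorphism of `U` — the converse of
`mem_autIdComponent_of_mdifferentiable`; together: `Aut⁰(𝕌)` = the holomorphic automorphisms
(print's `Aut⁰(𝕌) ≅ PSL₂(ℝ) ⊆ GL₂(ℝ)/ℝ^× ≅ Aut(𝕌)`).  Proof: the orientation test `V = i·U` is a
clopen condition on `Aut(𝕌)` (evaluation of disc pictures is compact-open continuous), holds at the
identity, and holds exactly at the Möbius-type (= biholomorphic) elements (Prop 2.2 (i):
`discAutHolIsoIsRCHolomorphic_holds`; `mdifferentiable_or_conj_of_discCosh_pic`).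
[cite: MochizukiAbsTopIII2015, Corollary 2.4 (b) p.54] -/
theorem autIdComponent_subset_setOf_mdifferentiable (hY : IsAutHolDisc Y) :
    autIdComponent (AutHolStructure.ofCharted Y) ⊆
      {φ : Y ≃ₜ Y | MDifferentiable 𝓘(ℂ, ℂ) 𝓘(ℂ, ℂ) φ ∧ MDifferentiable 𝓘(ℂ, ℂ) 𝓘(ℂ, ℂ) φ.symm} := by
  -- `Aut(U^top)` with the compact-open topology (Prop 2.2 (ii)), as in the definition of `autIdComponent`
  letI : TopologicalSpace (Y ≃ₜ Y) := homeoCompactOpen Y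
  obtain ⟨e, he, hes⟩ := hY.exists_biholomorphic
  set AU := AutHolStructure.ofCharted Y with hAU
  -- the disc picture of `ψ`, as a total function `ℂ → ℂ`
  let P : (Y ≃ₜ Y) → ℂ → ℂ := fun ψ =>
    Function.extend Subtype.val (Subtype.val ∘ (e.symm.trans (ψ.trans e))) fun _ => (0 : ℂ)
  have hPmem : ∀ ψ {z : ℂ}, z ∈ ball (0 : ℂ) 1 → P ψ z ∈ ball (0 : ℂ) 1 := fun ψ z hz =>
    mapsTo_extend _ hz
  have hPcont : ∀ {z : ℂ}, z ∈ ball (0 : ℂ) 1 → Continuous fun ψ : Y ≃ₜ Y => P ψ z :=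
    fun hz => continuous_pic_apply e hz
  -- the two test values `U(ψ) = φ_{g 0}(g(1/2))`, `V(ψ) = φ_{g 0}(g(i/2))`
  let Uf : (Y ≃ₜ Y) → ℂ := fun ψ => _root_.Complex.discMobius (P ψ 0) (P ψ (1 / 2))
  let Vf : (Y ≃ₜ Y) → ℂ := fun ψ => _root_.Complex.discMobius (P ψ 0) (P ψ (Complex.I / 2))
  have h0 : (0 : ℂ) ∈ ball (0 : ℂ) 1 := mem_ball_self one_pos
  -- continuity of the test values (joint continuity of `(a, z) ↦ φ_a(z)`)
  have hcontMob : ∀ {w : ℂ}, w ∈ ball (0 : ℂ) 1 →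
      Continuous fun ψ : Y ≃ₜ Y => _root_.Complex.discMobius (P ψ 0) (P ψ w) := by
    intro w hw
    have hc : Continuous fun ψ : Y ≃ₜ Y => (((1 : ℂ), P ψ 0), P ψ w) :=
      (continuous_const.prodMk (hPcont h0)).prodMk (hPcont hw)
    have hmem : ∀ ψ : Y ≃ₜ Y,
        (((1 : ℂ), P ψ 0), P ψ w) ∈ {q : (ℂ × ℂ) × ℂ | ‖q.1.2‖ < 1 ∧ ‖q.2‖ < 1} := fun ψ =>
      ⟨mem_ball_zero_iff.1 (hPmem ψ h0), mem_ball_zero_iff.1 (hPmem ψ hw)⟩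
    have h := continuousOn_discRot_uncurry.comp_continuous hc hmem
    refine h.congr fun ψ => ?_
    simp only [Function.comp_apply, discRot_apply, one_mul]
  have hUc : Continuous Uf := hcontMob half_mem_ball
  have hVc : Continuous Vf := hcontMob I_half_mem_ball
  -- the dichotomy on `Aut(𝕌)`: biholomorphic with `V = i·U`, or anti-type with `V = -i·U`; `U ≠ 0`
  have hdich : ∀ ψ : Y ≃ₜ Y, ψ ∈ autSet AU →
      ((MDifferentiable 𝓘(ℂ, ℂ) 𝓘(ℂ, ℂ) ψ ∧ MDifferentiable 𝓘(ℂ, ℂ) 𝓘(ℂ, ℂ) ψ.symm) ∧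
          Vf ψ = Complex.I * Uf ψ ∨ Vf ψ = -Complex.I * Uf ψ) ∧ Uf ψ ≠ 0 := by
    intro ψ hψ
    have hrc := discAutHolIsoIsRCHolomorphic_holds Y Y hY hY ψ hψ.1 hψ.2
    have hiso := discCosh_pic_of_isRCHolomorphic e he hes hrc.1 hrc.2
    rcases mdifferentiable_or_conj_of_discCosh_pic e he hes hiso with ⟨h1, h2⟩ | ⟨c, a, hc, ha, hconj⟩
    · obtain ⟨hV, hU⟩ := discMobius_apply_eq_I_mul_of_isDiscAut (isDiscAut_pic e he hes h1 h2)
      exact ⟨Or.inl ⟨⟨h1, h2⟩, hV⟩, hU⟩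
    · obtain ⟨hV, hU⟩ :=
        discMobius_apply_eq_neg_I_mul_of_eqOn_conj (g := P ψ) (isDiscAut_discRot hc ha) hconj
      exact ⟨Or.inr hV, hU⟩
  -- the clopen set `{V = i·U}` in the subspace `Aut(𝕌)`
  let Hol : Set (autSet AU) := {s | Vf s.1 = Complex.I * Uf s.1}
  have hHol_closed : IsClosed Hol :=
    isClosed_eq (hVc.comp continuous_subtype_val) ((continuous_const.mul hUc).comp continuous_subtype_val)
  have hHol_compl : Holᶜ = {s : autSet AU | Vf s.1 = -Complex.I * Uf s.1} := by
    ext s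
    obtain ⟨hor, hU⟩ := hdich s.1 s.2
    constructor
    · intro hs
      rcases hor with ⟨-, hV⟩ | hV
      · exact absurd hV hs
      · exact hV
    · intro hs hV
      have : Complex.I * Uf s.1 = -Complex.I * Uf s.1 := hV.symm.trans hs
      have h2 : (2 * Complex.I) * Uf s.1 = 0 := by linear_combination this
      rcases mul_eq_zero.1 h2 with h | h
      · exact (mul_ne_zero two_ne_zero Complex.I_ne_zero) h
      · exact hU h
  have hHol_open : IsOpen Hol := by
    rw [← isClosed_compl_iff, hHol_compl]
    exact isClosed_eq (hVc.comp continuous_subtype_val)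
      ((continuous_const.mul hUc).comp continuous_subtype_val)
  have hclopen : IsClopen Hol := ⟨hHol_closed, hHol_open⟩
  -- the identity lies in `Hol`
  let id₀ : autSet AU := ⟨Homeomorph.refl Y, AU.isMorphism_id, AU.isMorphism_id⟩
  have hid : id₀ ∈ Hol := by
    have hd : MDifferentiable 𝓘(ℂ, ℂ) 𝓘(ℂ, ℂ) (Homeomorph.refl Y) := mdifferentiable_id
    have hd' : MDifferentiable 𝓘(ℂ, ℂ) 𝓘(ℂ, ℂ) (Homeomorph.refl Y).symm := mdifferentiable_id
    exact (discMobius_apply_eq_I_mul_of_isDiscAut (isDiscAut_pic e he hes hd hd')).1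
  have hcomp : connectedComponent id₀ ⊆ Hol := hclopen.connectedComponent_subset hid
  -- conclusion
  rintro γ ⟨s, hs, rfl⟩
  have hsHol : Vf s.1 = Complex.I * Uf s.1 := hcomp hs
  obtain ⟨hor, hU⟩ := hdich s.1 s.2
  rcases hor with ⟨hbi, -⟩ | hV
  · exact hbi
  · exfalso
    have : Complex.I * Uf s.1 = -Complex.I * Uf s.1 := hsHol.symm.trans hV
    have h2 : (2 * Complex.I) * Uf s.1 = 0 := by linear_combination this
    rcases mul_eq_zero.1 h2 with h | h
    · exact (mul_ne_zero two_ne_zero Complex.I_ne_zero) h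
    · exact hU h

/-- **`Aut⁰(𝕌)` = the biholomorphic self-homeomorphisms of the Aut-holomorphic disc `U`** (as sets),
combining the converse above with abc-iut-L4-t8's `mem_autIdComponent_of_mdifferentiable`
(`Aut⁰(𝕌) ≅ PSL₂(ℝ)` inside `Aut(𝕌) ≅ GL₂(ℝ)/ℝ^×`, Prop 2.2 (ii)/Cor 2.4 (b)).
[cite: MochizukiAbsTopIII2015, Corollary 2.4 (b) p.54] -/
theorem autIdComponent_eq_setOf_mdifferentiable (hY : IsAutHolDisc Y) :
    autIdComponent (AutHolStructure.ofCharted Y) =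
      {φ : Y ≃ₜ Y | MDifferentiable 𝓘(ℂ, ℂ) 𝓘(ℂ, ℂ) φ ∧ MDifferentiable 𝓘(ℂ, ℂ) 𝓘(ℂ, ℂ) φ.symm} :=
  Subset.antisymm (autIdComponent_subset_setOf_mdifferentiable hY) fun φ hφ =>
    mem_autIdComponent_of_mdifferentiable hY φ hφ.1 hφ.2

/-- Membership form: an element of `Aut⁰(𝕌)` is biholomorphic (in particular the commensurator
`Π ≤ Aut⁰(𝕌)` of Cor 2.4 (c) acts on `U` by holomorphic automorphisms).
[cite: MochizukiAbsTopIII2015, Corollary 2.4 (c) p.55] -/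
theorem mdifferentiable_of_mem_autIdComponent (hY : IsAutHolDisc Y) {γ : Y ≃ₜ Y}
    (hγ : γ ∈ autIdComponent (AutHolStructure.ofCharted Y)) :
    MDifferentiable 𝓘(ℂ, ℂ) 𝓘(ℂ, ℂ) γ ∧ MDifferentiable 𝓘(ℂ, ℂ) 𝓘(ℂ, ℂ) γ.symm :=
  autIdComponent_subset_setOf_mdifferentiable hY hγ

/-- For a subgroup `G` of `Aut(U^top)` whose carrier is `Aut⁰(𝕌)` (the binder of
`HyperbolicCoreOrbispace` / `exists_hyperbolicCore_data_of_nonabelian_fundamentalGroup_holds`), every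
element of `G` — hence of any subgroup `Π ≤ G`, e.g. the commensurator of the deck group — is a
biholomorphic automorphism of `U`. [cite: MochizukiAbsTopIII2015, Corollary 2.4 (c) p.55] -/
theorem mdifferentiable_of_mem_of_coe_eq_autIdComponent (hY : IsAutHolDisc Y) {G : Subgroup (Y ≃ₜ Y)}
    (hG : (G : Set (Y ≃ₜ Y)) = autIdComponent (AutHolStructure.ofCharted Y)) {γ : Y ≃ₜ Y}
    (hγ : γ ∈ G) : MDifferentiable 𝓘(ℂ, ℂ) 𝓘(ℂ, ℂ) γ ∧ MDifferentiable 𝓘(ℂ, ℂ) 𝓘(ℂ, ℂ) γ.symm := by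
  have : γ ∈ (G : Set (Y ≃ₜ Y)) := hγ
  rw [hG] at this
  exact mdifferentiable_of_mem_autIdComponent hY this

end IdComponent

end Literature.AnabelianGeometry.AbsoluteAnabelian

end
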